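import Literature.NumberTheory.Transcendental.KZLogCalculusProofs
import Literature.NumberTheory.Transcendental.KZMellinFibres
import Literature.NumberTheory.Transcendental.KZDominatedFamilyRelations
import Summits.KontsevichZagierPeriods.KontsevichZagierPeriods.Theorems.HurwitzMicroSectorsNormalFormPrincipleLevelOneExistsRep

/-!
# `NormalFormPrinciple` (stmt-KontsevichZagierPeriods-3869), line `SketchIdeator1` — leaf
# `stub_boxRigidity`, dimension two off the product type (`FiveZetaTwoOffProduct`):
# product rule instances

Registered sub-goal `logMonomial_mul_instances` of the layer `FiveZetaTwoOffProduct` (lead file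
`…FiveZetaTwo`). Write `σ = {0 < x < 1} ⊆ ℝ¹` and, for `v ≥ 1` on `σ`,
`M(v) = [{x ∈ σ, 1 ≤ s ≤ v x}, (1/x)/s]` for any integral representation with this domain (a
`KZlog.band`) and this integrand on it (the unfolded log monomial `∫₀¹ log v(x) dx/x`). The unfolded
product rule `log (u w) = log u + log w` of the KZ calculus (`KZ.of_sub_of_sub_mem_relations_mul`:
rule 1a, splitting the band at `s = u x`, and rule 2, the substitution `s = u(x) s'`) gives
`M(u w) − M(u) − M(w) ∈ relations`; we record the three instances used by the chain:

* `M(1/(1−x)) − M(1+x+x²) − M(1/(1−x³))`, since `(1+x+x²)/(1−x³) = 1/(1−x)` on `σ`;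
* `M(1/(1−x)) − M(1+x) − M(1/(1−x²))`, since `(1+x)/(1−x²) = 1/(1−x)` on `σ`;
* `M(1+x+x²) − M(1+x²) − M((1+x+x²)/(1+x²))`.

The bands only depend on the values of the upper edge on `σ` (`KZlog.band_congr`), so the product
band `{1 ≤ s ≤ u x · w x}` is identified with the stated one by a pointwise identity on `σ`.
References: M. Kontsevich, D. Zagier, *Periods* (2001), §1.2, rules (1), (2). No new definitions.
-/

noncomputable section

open MeasureTheory Set
open Literature.NumberTheory.Transcendental Literature.NumberTheory.Transcendental.KZ
open Literature.ModelTheory.ExponentialFields (IsSemialgebraic)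

namespace Summit.KontsevichZagierPeriods.HurwitzMicroSectors.NormalFormPrinciple.PiBox.M2

/-- **The unfolded product rule for log monomials with weight `1/x`.** For `ℚ`-semialgebraic
`u, w ≥ 1` on a `ℚ`-semialgebraic `σ ⊆ ℝ¹` and `v = u w` on `σ`, any representations
`R = [{1 ≤ s ≤ v}, (1/x)/s]`, `R₁ = [{1 ≤ s ≤ u}, (1/x)/s]`, `R₂ = [{1 ≤ s ≤ w}, (1/x)/s]` over `σ`
satisfy `R − R₁ − R₂ ∈ relations` (`KZ.of_sub_of_sub_mem_relations_mul` with `g = 1/x`, the band of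
`R` being rewritten by `KZlog.band_congr`). [cite: KontsevichZagier2001, §1.2] -/
theorem of_sub_of_sub_mem_relations_logMonomial {σ : Set (Fin 1 → ℝ)} {u w v : (Fin 1 → ℝ) → ℝ}
    (hσ : IsSemialgebraic ℚ σ) (hu : IsSemialgebraicFunOn ℚ σ u) (hw : IsSemialgebraicFunOn ℚ σ w)
    (hu1 : ∀ x ∈ σ, 1 ≤ u x) (hw1 : ∀ x ∈ σ, 1 ≤ w x) (hv : ∀ x ∈ σ, v x = u x * w x)
    (R R₁ R₂ : IntegralRep 2)
    (hRd : R.domain = KZlog.band σ (fun _ => (1:ℝ)) v)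
    (hRi : EqOn R.integrand (fun z => (1 / z 0) / z 1) R.domain)
    (hR₁d : R₁.domain = KZlog.band σ (fun _ => (1:ℝ)) u)
    (hR₁i : EqOn R₁.integrand (fun z => (1 / z 0) / z 1) R₁.domain)
    (hR₂d : R₂.domain = KZlog.band σ (fun _ => (1:ℝ)) w)
    (hR₂i : EqOn R₂.integrand (fun z => (1 / z 0) / z 1) R₂.domain) :
    of R - of R₁ - of R₂ ∈ relations :=
  KZ.of_sub_of_sub_mem_relations_mul (g := fun y => 1 / y 0) hσ hu hw hu1 hw1 R R₁ R₂
    (hRd.trans (KZlog.band_congr fun x hx => hv x hx)) hRi hR₁d hR₁i hR₂d hR₂i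

/-- `1 + x + x²` is `ℚ`-semialgebraic on `σ = (0,1) ⊆ ℝ¹` (a polynomial). [folklore] -/
theorem isSemialgebraicFunOn_one_add_add_sq :
    IsSemialgebraicFunOn ℚ {y : Fin 1 → ℝ | 0 < y 0 ∧ y 0 < 1} (fun y => 1 + y 0 + y 0 ^ 2) :=
  (isSemialgebraicFunOn_aeval isSemialgebraic_unitInterval_fin_one
    (1 + MvPolynomial.X 0 + MvPolynomial.X 0 ^ 2 : MvPolynomial (Fin 1) ℚ)).congr fun x _ => by simp

/-- `1 + x` is `ℚ`-semialgebraic on `σ = (0,1) ⊆ ℝ¹` (a polynomial). [folklore] -/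
theorem isSemialgebraicFunOn_one_add :
    IsSemialgebraicFunOn ℚ {y : Fin 1 → ℝ | 0 < y 0 ∧ y 0 < 1} (fun y => 1 + y 0) :=
  (isSemialgebraicFunOn_aeval isSemialgebraic_unitInterval_fin_one
    (1 + MvPolynomial.X 0 : MvPolynomial (Fin 1) ℚ)).congr fun x _ => by simp

/-- `1 + x²` is `ℚ`-semialgebraic on `σ = (0,1) ⊆ ℝ¹` (a polynomial). [folklore] -/
theorem isSemialgebraicFunOn_one_add_sq :
    IsSemialgebraicFunOn ℚ {y : Fin 1 → ℝ | 0 < y 0 ∧ y 0 < 1} (fun y => 1 + y 0 ^ 2) :=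
  (isSemialgebraicFunOn_aeval isSemialgebraic_unitInterval_fin_one
    (1 + MvPolynomial.X 0 ^ 2 : MvPolynomial (Fin 1) ℚ)).congr fun x _ => by simp

/-- `1/(1 − xᵏ)` (`k ≠ 0`) is `ℚ`-semialgebraic on `σ = (0,1) ⊆ ℝ¹` (a rational function whose
denominator does not vanish on `σ`). [folklore] -/
theorem isSemialgebraicFunOn_one_div_one_sub_pow {k : ℕ} (hk : k ≠ 0) :
    IsSemialgebraicFunOn ℚ {y : Fin 1 → ℝ | 0 < y 0 ∧ y 0 < 1} (fun y => 1 / (1 - y 0 ^ k)) := by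
  refine (isSemialgebraicFunOn_aeval_div_aeval isSemialgebraic_unitInterval_fin_one 1
    (1 - MvPolynomial.X 0 ^ k : MvPolynomial (Fin 1) ℚ) fun x hx => ?_).congr fun x _ => by simp
  have : x 0 ^ k < 1 := pow_lt_one₀ hx.1.le hx.2 hk
  simp only [map_sub, map_one, map_pow, MvPolynomial.aeval_X]
  exact (sub_pos.2 this).ne'

/-- `(1 + x + x²)/(1 + x²)` is `ℚ`-semialgebraic on `σ = (0,1) ⊆ ℝ¹` (a rational function whose
denominator does not vanish). [folklore] -/
theorem isSemialgebraicFunOn_quadRatio :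
    IsSemialgebraicFunOn ℚ {y : Fin 1 → ℝ | 0 < y 0 ∧ y 0 < 1}
      (fun y => (1 + y 0 + y 0 ^ 2) / (1 + y 0 ^ 2)) := by
  refine (isSemialgebraicFunOn_aeval_div_aeval isSemialgebraic_unitInterval_fin_one
    (1 + MvPolynomial.X 0 + MvPolynomial.X 0 ^ 2 : MvPolynomial (Fin 1) ℚ)
    (1 + MvPolynomial.X 0 ^ 2) fun x _ => ?_).congr fun x _ => by simp
  simp only [map_add, map_one, map_pow, MvPolynomial.aeval_X]
  positivity

/-- **Product rule instance (1):** `M(1/(1−x)) − M(1+x+x²) − M(1/(1−x³)) ∈ relations`, from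
`(1 + x + x²) · 1/(1 − x³) = 1/(1 − x)` on `(0,1)`. [cite: KontsevichZagier2001, §1.2] -/
theorem logMonomial_mul_instance₁ (L A M₃ : IntegralRep 2)
    (hLd : L.domain = KZlog.band {y : Fin 1 → ℝ | 0 < y 0 ∧ y 0 < 1} (fun _ => (1:ℝ))
      (fun y => 1 / (1 - y 0)))
    (hLi : EqOn L.integrand (fun z => (1 / z 0) / z 1) L.domain)
    (hAd : A.domain = KZlog.band {y : Fin 1 → ℝ | 0 < y 0 ∧ y 0 < 1} (fun _ => (1:ℝ))
      (fun y => 1 + y 0 + y 0 ^ 2))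
    (hAi : EqOn A.integrand (fun z => (1 / z 0) / z 1) A.domain)
    (hMd : M₃.domain = KZlog.band {y : Fin 1 → ℝ | 0 < y 0 ∧ y 0 < 1} (fun _ => (1:ℝ))
      (fun y => 1 / (1 - y 0 ^ 3)))
    (hMi : EqOn M₃.integrand (fun z => (1 / z 0) / z 1) M₃.domain) :
    of L - of A - of M₃ ∈ relations := by
  refine of_sub_of_sub_mem_relations_logMonomial isSemialgebraic_unitInterval_fin_one
    isSemialgebraicFunOn_one_add_add_sq (isSemialgebraicFunOn_one_div_one_sub_pow three_ne_zero)
    (fun x hx => ?_) (fun x hx => ?_) (fun x hx => ?_) L A M₃ hLd hLi hAd hAi hMd hMi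
  · nlinarith [hx.1]
  · have h3 : x 0 ^ 3 < 1 := pow_lt_one₀ hx.1.le hx.2 three_ne_zero
    rw [le_div_iff₀ (sub_pos.2 h3)]
    nlinarith [pow_pos hx.1 3]
  · have h1 : (1 : ℝ) - x 0 ≠ 0 := (sub_pos.2 hx.2).ne'
    have h3 : (1 : ℝ) - x 0 ^ 3 = (1 - x 0) * (1 + x 0 + x 0 ^ 2) := by ring
    have h2 : (1 : ℝ) + x 0 + x 0 ^ 2 ≠ 0 := by nlinarith [hx.1]
    rw [h3]
    field_simp

/-- **Product rule instance (2):** `M(1/(1−x)) − M(1+x) − M(1/(1−x²)) ∈ relations`, from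
`(1 + x) · 1/(1 − x²) = 1/(1 − x)` on `(0,1)`. [cite: KontsevichZagier2001, §1.2] -/
theorem logMonomial_mul_instance₂ (L P M₂ : IntegralRep 2)
    (hLd : L.domain = KZlog.band {y : Fin 1 → ℝ | 0 < y 0 ∧ y 0 < 1} (fun _ => (1:ℝ))
      (fun y => 1 / (1 - y 0)))
    (hLi : EqOn L.integrand (fun z => (1 / z 0) / z 1) L.domain)
    (hPd : P.domain = KZlog.band {y : Fin 1 → ℝ | 0 < y 0 ∧ y 0 < 1} (fun _ => (1:ℝ))
      (fun y => 1 + y 0))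
    (hPi : EqOn P.integrand (fun z => (1 / z 0) / z 1) P.domain)
    (hMd : M₂.domain = KZlog.band {y : Fin 1 → ℝ | 0 < y 0 ∧ y 0 < 1} (fun _ => (1:ℝ))
      (fun y => 1 / (1 - y 0 ^ 2)))
    (hMi : EqOn M₂.integrand (fun z => (1 / z 0) / z 1) M₂.domain) :
    of L - of P - of M₂ ∈ relations := by
  refine of_sub_of_sub_mem_relations_logMonomial isSemialgebraic_unitInterval_fin_one
    isSemialgebraicFunOn_one_add (isSemialgebraicFunOn_one_div_one_sub_pow two_ne_zero)
    (fun x hx => ?_) (fun x hx => ?_) (fun x hx => ?_) L P M₂ hLd hLi hPd hPi hMd hMi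
  · linarith [hx.1]
  · have h2 : x 0 ^ 2 < 1 := pow_lt_one₀ hx.1.le hx.2 two_ne_zero
    rw [le_div_iff₀ (sub_pos.2 h2)]
    nlinarith [pow_pos hx.1 2]
  · have h1 : (1 : ℝ) - x 0 ≠ 0 := (sub_pos.2 hx.2).ne'
    have h3 : (1 : ℝ) - x 0 ^ 2 = (1 - x 0) * (1 + x 0) := by ring
    have h2 : (1 : ℝ) + x 0 ≠ 0 := by linarith [hx.1]
    rw [h3]
    field_simp

/-- **Product rule instance (3):** `M(1+x+x²) − M(1+x²) − M((1+x+x²)/(1+x²)) ∈ relations`, from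
`(1 + x²) · (1 + x + x²)/(1 + x²) = 1 + x + x²` on `(0,1)`. [cite: KontsevichZagier2001, §1.2] -/
theorem logMonomial_mul_instance₃ (A B W : IntegralRep 2)
    (hAd : A.domain = KZlog.band {y : Fin 1 → ℝ | 0 < y 0 ∧ y 0 < 1} (fun _ => (1:ℝ))
      (fun y => 1 + y 0 + y 0 ^ 2))
    (hAi : EqOn A.integrand (fun z => (1 / z 0) / z 1) A.domain)
    (hBd : B.domain = KZlog.band {y : Fin 1 → ℝ | 0 < y 0 ∧ y 0 < 1} (fun _ => (1:ℝ))
      (fun y => 1 + y 0 ^ 2))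
    (hBi : EqOn B.integrand (fun z => (1 / z 0) / z 1) B.domain)
    (hWd : W.domain = KZlog.band {y : Fin 1 → ℝ | 0 < y 0 ∧ y 0 < 1} (fun _ => (1:ℝ))
      (fun y => (1 + y 0 + y 0 ^ 2) / (1 + y 0 ^ 2)))
    (hWi : EqOn W.integrand (fun z => (1 / z 0) / z 1) W.domain) :
    of A - of B - of W ∈ relations := by
  refine of_sub_of_sub_mem_relations_logMonomial isSemialgebraic_unitInterval_fin_one
    isSemialgebraicFunOn_one_add_sq isSemialgebraicFunOn_quadRatio
    (fun x hx => ?_) (fun x hx => ?_) (fun x hx => ?_) A B W hAd hAi hBd hBi hWd hWi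
  · nlinarith [hx.1]
  · have h2 : (0 : ℝ) < 1 + x 0 ^ 2 := by positivity
    rw [le_div_iff₀ h2]
    linarith [hx.1]
  · have h2 : (1 : ℝ) + x 0 ^ 2 ≠ 0 := by positivity
    field_simp

/-- **Stub M (product rule instances, rules 1a + 2).** With
`M(v) = [{0 < x < 1, 1 ≤ s ≤ v x}, (1/x)/s]` (any representation with this band as domain and this
integrand on it): `M(1/(1−x)) − M(1+x+x²) − M(1/(1−x³))`, `M(1/(1−x)) − M(1+x) − M(1/(1−x²))` and
`M(1+x+x²) − M(1+x²) − M((1+x+x²)/(1+x²))` are KZ relations — three instances of the unfolded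
product rule `log (u w) = log u + log w`. [cite: KontsevichZagier2001, §1.2] -/
theorem logMonomial_mul_instances :
    (∀ (L A M₃ : IntegralRep 2),
      L.domain = KZlog.band {y : Fin 1 → ℝ | 0 < y 0 ∧ y 0 < 1} (fun _ => (1:ℝ))
        (fun y => 1 / (1 - y 0)) →
      EqOn L.integrand (fun z => (1 / z 0) / z 1) L.domain →
      A.domain = KZlog.band {y : Fin 1 → ℝ | 0 < y 0 ∧ y 0 < 1} (fun _ => (1:ℝ))
        (fun y => 1 + y 0 + y 0 ^ 2) →
      EqOn A.integrand (fun z => (1 / z 0) / z 1) A.domain →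
      M₃.domain = KZlog.band {y : Fin 1 → ℝ | 0 < y 0 ∧ y 0 < 1} (fun _ => (1:ℝ))
        (fun y => 1 / (1 - y 0 ^ 3)) →
      EqOn M₃.integrand (fun z => (1 / z 0) / z 1) M₃.domain →
      of L - of A - of M₃ ∈ relations) ∧
    (∀ (L P M₂ : IntegralRep 2),
      L.domain = KZlog.band {y : Fin 1 → ℝ | 0 < y 0 ∧ y 0 < 1} (fun _ => (1:ℝ))
        (fun y => 1 / (1 - y 0)) →
      EqOn L.integrand (fun z => (1 / z 0) / z 1) L.domain →
      P.domain = KZlog.band {y : Fin 1 → ℝ | 0 < y 0 ∧ y 0 < 1} (fun _ => (1:ℝ))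
        (fun y => 1 + y 0) →
      EqOn P.integrand (fun z => (1 / z 0) / z 1) P.domain →
      M₂.domain = KZlog.band {y : Fin 1 → ℝ | 0 < y 0 ∧ y 0 < 1} (fun _ => (1:ℝ))
        (fun y => 1 / (1 - y 0 ^ 2)) →
      EqOn M₂.integrand (fun z => (1 / z 0) / z 1) M₂.domain →
      of L - of P - of M₂ ∈ relations) ∧
    (∀ (A B W : IntegralRep 2),
      A.domain = KZlog.band {y : Fin 1 → ℝ | 0 < y 0 ∧ y 0 < 1} (fun _ => (1:ℝ))
        (fun y => 1 + y 0 + y 0 ^ 2) →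
      EqOn A.integrand (fun z => (1 / z 0) / z 1) A.domain →
      B.domain = KZlog.band {y : Fin 1 → ℝ | 0 < y 0 ∧ y 0 < 1} (fun _ => (1:ℝ))
        (fun y => 1 + y 0 ^ 2) →
      EqOn B.integrand (fun z => (1 / z 0) / z 1) B.domain →
      W.domain = KZlog.band {y : Fin 1 → ℝ | 0 < y 0 ∧ y 0 < 1} (fun _ => (1:ℝ))
        (fun y => (1 + y 0 + y 0 ^ 2) / (1 + y 0 ^ 2)) →
      EqOn W.integrand (fun z => (1 / z 0) / z 1) W.domain →
      of A - of B - of W ∈ relations) :=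
  ⟨logMonomial_mul_instance₁, logMonomial_mul_instance₂, logMonomial_mul_instance₃⟩

end Summit.KontsevichZagierPeriods.HurwitzMicroSectors.NormalFormPrinciple.PiBox.M2
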